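import Summits.Ventures.HSemireg.WedgePointPairPowersPerQRank

/-!
# Venture HSemireg — per-`q` blocks of the `n`-fold box of `m`-dimensional point pairs, companion: THE EXACT SUPPORT (RESIDUE LAW)
# of every per-`q` row — block `q` of degree `k` is non-zero iff `k + q ≤ mn` and `q ≡ −s (mod m)` for some `0 ≤ s ≤ k` — for
# EVERY `m ≥ 1`, `n`, `k`

HONEST FRAMING. Part of the Lean index of the computation cell `pub-hsemireg` (seat p10 gen 5, Sunday typer «UNIFORM-IN-n»).
Finite combinatorics of th-7's canonical sources + the rank theorem of `WedgePointPairPowersPerQRank.lean` ONLY: no variety, no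
cohomology theory, no sheaf, no Ext group, no semiregularity map is constructed here; nothing here says that HC / HC_CM / HC_AV holds;
no Literature fact is declared or used.  Custodian versions: STRUCTURE.md v1.0-SIGNED 9b196a05977dd067 (§1.1 C13: the inner zeros of the
signed rows `(28,0,12,32,12,0,28)`, `(45,0,0,20,50,20,0,0,45)`), theory/FORMULA-N.md PART A §4.1″ (th-6) / PART B §G (th-7).  Dictionary
quoted, not asserted (degree `k` ↔ `Ext^k`, block `q` ↔ Dolbeault index `H^{q+k}(Ω^q)`, `q`-part `m − |t|` of an `X`-source = its local
component, `θ ↦ θ ∧ F` ↔ `⌟ch(F)`).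

THIS FILE, uniformly in `m`, `n` AND the degree `k` (the closed rows of `…PerQDegreeOne/Two/Three` and the extreme blocks of
`…PerQExtreme` are consistent instances): WHERE the per-`q` row is non-zero.
§1 NECESSITY.  For option data `f`, the fixed `q`-part plus the number `s(f)` of letters on NON-EMPTY `X`-type blocks is a multiple of
`m` — each such block contributes `(m − |o|) + |o| = m`, every other block `0 + 0` — and `s(f) ≤ k(f)` (`exists_dvd_qff_add`);
with `|o| + q_f(o) + m·z(o) ≤ m` blockwise, `k + q ≤ mn` for every class reaching `q` (`add_le_of_mem_Fset`; cf. the sibling leaf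
`WedgePointPairPowersPerQSymm.Fset_eq_empty_of_add_lt`, not imported here).
§2 so a degree-`k` class reaches block `q` only if `m ∣ q + s` for some `s ≤ k` (`exists_dvd_of_mem_Fset`); VANISHING FORMS: if
`m ∤ q + s` for every `s ≤ k` — in residues, `(m − q % m) % m > k` (`forall_not_dvd_of_lt_mod`) — the `q`-block is zero for every field and
`a, c ≠ 0` and `genCount m n k q = 0` (`…_eq_zero_of_forall_not_dvd`, `…_eq_zero_of_lt_mod`); the inner zeros of record
(`genCount_residue_zeros`, EVERY `n`): threefold factors degree 1 at `q ≡ 1 (3)` (the `0`s of `(9,0,9,9,0,9,9,0,9,0)`); fourfold factors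
degree 2 at `q ≡ 1 (4)` (the `0`s of `(66,0,18,96,66,0,66,96,18,0,66,0,0)` and of C13's `(28,0,12,32,12,0,28)`), degree 1 at `q ≡ 1, 2 (4)`;
fivefold factors degree 2 at `q ≡ 1, 2 (5)` (C13's `(45,0,0,20,50,20,0,0,45)`).
§3 SUFFICIENCY, by induction on `n` (`exists_mem_Fset`): given `k + q ≤ m(n+1)`, `s ≤ k`, `m ∣ q + s`, the FIRST block is chosen as —
`1 ≤ s ≤ m`: an `X`-source with `s` letters (`q`-part `m − s`); `s > m`: the top collapse `X` (`m` letters, `q`-part `0`); `s = 0`,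
`q ≥ m`: the empty source, shifted once; `s = 0`, `q = 0`: the top collapse (`k ≥ m`), a proper `Y`-source with `k` letters
(`1 ≤ k < m`) or the empty source (`k = 0`) — and the remaining `(k', q', s')` satisfies the same three conditions on `n` blocks.
§4 **THE EXACT SUPPORT THEOREM** (`Fset_nonempty_iff`; rank form `finrank_range_blockProj_wedge_pairBox_ne_zero_iff` for every field and
`a, c ≠ 0`; arithmetic form `genCount_ne_zero_iff`):  **block `q` of degree `k` is non-zero ⟺ `k + q ≤ mn ∧ ∃ s ≤ k, m ∣ q + s`** —
the degree-`k` row lives exactly on the window `q ≤ mn − k` intersected with the `k + 1` residues `q ≡ 0, −1, …, −k (mod m)` (all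
residues once `k ≥ m − 1`); in residue arithmetic the divisibility condition reads `(m − q % m) % m ≤ k` (`exists_dvd_iff_mod_le`).
§5 at two factors in degree 2 (`m ≥ 3`) the support is EXACTLY STRUCTURE C13's five Dolbeault indices `(0, m−2, m−1, m, 2m−2)`
(`genCount_two_factors_two_ne_zero_iff`, rank form `…_two_factors_two_ne_zero_iff`).
WHAT IS NOT HERE: the VALUE of a non-zero block (the closed rows `k ≤ 3` and `genCount` give it); anything Ext-side.  Namespace
`Summit.Ventures.HSemireg.Wedge.PairPowers`; new names only, no new definition; a LEAF over
`WedgePointPairPowersPerQRank.lean`, independent of the sibling leaves.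
-/

open Module
open Module

namespace Summit.Ventures.HSemireg.Wedge.PairPowers

open Summit.Ventures.HSemireg.Wedge Summit.Ventures.HSemireg.Wedge.Kunneth

variable (K : Type*) [Field K] {m : ℕ} {n : ℕ}

/-! ## §1. Necessity: letters on non-empty `X`-type blocks, and the window -/

/-- ONE block: there is `s ≤ |o|` with `m ∣ q_f(o) + s` — `s = |o|` on a non-empty `X`-source (`(m − |o|) + |o| = m`, `|o| ≤ |X| = m`),
`s = 0` otherwise (`q`-part `0`). -/
lemma exists_dvd_lqf_add (o : Opt m) : ∃ s, s ≤ o.1.card ∧ m ∣ lqf m o + s := by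
  by_cases h : o.1 ⊆ Xs m ∧ o.1 ≠ ∅
  · have e : lqf m o = m - o.1.card := if_pos h
    have hle : o.1.card ≤ m := (Finset.card_le_card h.1).trans (WedgePair.card_Xset m).le
    refine ⟨o.1.card, le_rfl, ?_⟩
    rw [e, Nat.sub_add_cancel hle]
  · have e : lqf m o = 0 := if_neg h
    exact ⟨0, Nat.zero_le _, by rw [e]; exact dvd_zero m⟩

/-- **option data: there is `s ≤ k(f)` with `m ∣ q_f(f) + s`** (`s` = the number of letters on non-empty `X`-type blocks). -/
theorem exists_dvd_qff_add (f : Fin n → Opt m) : ∃ s, s ≤ kf f ∧ m ∣ qff f + s := by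
  choose s hs hd using fun i => exists_dvd_lqf_add (f i)
  refine ⟨∑ i, s i, Finset.sum_le_sum fun i _ => hs i, ?_⟩
  rw [qff, ← Finset.sum_add_distrib]
  exact Finset.dvd_sum fun i _ => hd i

/-- blockwise: `|o| + q_f(o) + m·z(o) ≤ m` (`X`-source: `|o| + (m − |o|) + 0`; proper `Y`-source: `|o| < m`; empty: `0 + 0 + m`). -/
lemma card_add_lqf_add_lz_le (o : Opt m) : o.1.card + lqf m o + m * lz m o ≤ m := by
  have e1 : lqf m o = if o.1 ⊆ Xs m ∧ o.1 ≠ ∅ then m - o.1.card else 0 := rfl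
  have e2 : lz m o = if o.1 = ∅ then 1 else 0 := rfl
  rcases mem_optSet.mp o.2 with hX | ⟨-, hpos, hlt⟩
  · have hle : o.1.card ≤ m := (Finset.card_le_card hX).trans (WedgePair.card_Xset m).le
    by_cases h0 : o.1 = ∅
    · rw [e1, e2, if_pos h0, if_neg (fun h => h.2 h0), h0, Finset.card_empty]
      omega
    · rw [e1, e2, if_neg h0, if_pos ⟨hX, h0⟩]
      omega
  · have h0 : o.1 ≠ ∅ := fun h => by rw [h, Finset.card_empty] at hpos; exact lt_irrefl 0 hpos
    rw [e1, e2, if_neg h0]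
    split_ifs <;> omega

/-- hence `k(f) + q_f(f) + m·z(f) ≤ mn` for all option data. -/
theorem kf_add_qff_add_zf_le (f : Fin n → Opt m) : kf f + qff f + m * zf f ≤ m * n := by
  calc kf f + qff f + m * zf f = ∑ i, (((f i).1).card + lqf m (f i) + m * lz m (f i)) := by
        rw [kf, qff, zf, Finset.mul_sum, ← Finset.sum_add_distrib, ← Finset.sum_add_distrib]
    _ ≤ ∑ _i : Fin n, m := Finset.sum_le_sum fun i _ => card_add_lqf_add_lz_le (f i)
    _ = m * n := by rw [Finset.sum_const, Finset.card_univ, Fintype.card_fin, smul_eq_mul, mul_comm]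

/-- **the window**: a degree-`k` class reaching block `q` has `k + q ≤ mn` (here from the blockwise inequality; the sibling leaf
`WedgePointPairPowersPerQSymm` has it as `Fset_eq_empty_of_add_lt`, via the involution). -/
theorem add_le_of_mem_Fset {k q : ℕ} {f : Fin n → Opt m} (hf : f ∈ Fset m n k q) : k + q ≤ m * n := by
  obtain ⟨hk, j, hj, hq⟩ := mem_Fset.mp hf
  have h := kf_add_qff_add_zf_le f
  have hmj : m * j ≤ m * zf f := Nat.mul_le_mul_left m hj
  omega

/-! ## §2. Necessity as vanishing: residue form and the zeros of record -/

/-- **a degree-`k` class reaching block `q` forces `m ∣ q + s` for some `s ≤ k`** (`q = q_f + jm` and §1). -/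
theorem exists_dvd_of_mem_Fset {k q : ℕ} {f : Fin n → Opt m} (hf : f ∈ Fset m n k q) : ∃ s, s ≤ k ∧ m ∣ q + s := by
  obtain ⟨hk, j, -, hq⟩ := mem_Fset.mp hf
  obtain ⟨s, hs, hd⟩ := exists_dvd_qff_add f
  refine ⟨s, hk ▸ hs, ?_⟩
  rw [hq, add_right_comm]
  exact dvd_add hd (dvd_mul_right m j)

/-- **THE RESIDUE SUPPORT LAW (class form)**: if `m ∤ q + s` for every `s ≤ k`, no degree-`k` class reaches block `q`. -/
theorem Fset_eq_empty_of_forall_not_dvd {k q : ℕ} (h : ∀ s, s ≤ k → ¬ m ∣ q + s) : Fset m n k q = ∅ :=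
  Finset.eq_empty_of_forall_notMem fun f hf => by
    obtain ⟨s, hs, hd⟩ := exists_dvd_of_mem_Fset hf
    exact h s hs hd

/-- **THE RESIDUE SUPPORT LAW (rank form), UNIFORM IN `m`, `n` AND `k`.**  For every field `K`, every `m ≥ 1`, `n`, `k`, `q` and
`a, c ≠ 0`: if `m ∤ q + s` for every `s ≤ k`, the `q`-block of `θ ↦ θ ∧ F` on `⋀^k K^{(m+m)n}` is zero — the degree-`k` per-`q` row is
supported on the `k + 1` residues `q ≡ 0, −1, …, −k (mod m)` (a class of degree `k` puts `s ≤ k` letters on non-empty `X`-type blocks,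
whose `q`-parts are `m − |o|`; every other block has `q`-part `0`; the shifts are multiples of `m`). -/
theorem finrank_range_blockProj_wedge_pairBox_eq_zero_of_forall_not_dvd (hm : 1 ≤ m) {a c : K} (ha : a ≠ 0) (hc : c ≠ 0)
    {k q : ℕ} (h : ∀ s, s ≤ k → ¬ m ∣ q + s) :
    finrank K (LinearMap.range (blockProj K m n q ∘ₗ wedge K (Fin ((m + m) * n)) k (pairBox K (m := m) (n := n) a c))) = 0 := by
  rw [finrank_range_blockProj_wedge_pairBox_eq_card K hm ha hc, Fset_eq_empty_of_forall_not_dvd h, Finset.card_empty]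

/-- the same as arithmetic of p10's enumerator: **`genCount m n k q = 0`** if `m ∤ q + s` for every `s ≤ k` (`m ≥ 1`). -/
theorem genCount_eq_zero_of_forall_not_dvd (hm : 1 ≤ m) (n : ℕ) {k q : ℕ} (h : ∀ s, s ≤ k → ¬ m ∣ q + s) :
    FormulaN.Uniform.genCount m n k q = 0 := by
  rw [← card_Fset (n := n) hm, Fset_eq_empty_of_forall_not_dvd h, Finset.card_empty]

/-- residue form of the hypothesis: if `k < (m − q % m) % m` — i.e. `q % m ≠ 0` and `q % m < m − k` — then `m ∤ q + s` for every
`s ≤ k` (`m ≥ 1`). -/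
theorem forall_not_dvd_of_lt_mod (hm : 1 ≤ m) {k q : ℕ} (hk : k < (m - q % m) % m) : ∀ s, s ≤ k → ¬ m ∣ q + s := by
  intro s hs hd
  have h0 : q % m ≠ 0 := by
    intro h0
    rw [h0, Nat.sub_zero, Nat.mod_self] at hk
    exact Nat.not_lt_zero k hk
  have hlt : q % m < m := Nat.mod_lt q (by omega)
  have hk' : k < m - q % m := by rwa [Nat.mod_eq_of_lt (show m - q % m < m by omega)] at hk
  have hmod : (q + s) % m = q % m + s := by
    rw [Nat.add_mod, Nat.mod_eq_of_lt (show s < m by omega), Nat.mod_eq_of_lt (show q % m + s < m by omega)]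
  have h2 : (q + s) % m = 0 := Nat.mod_eq_zero_of_dvd hd
  omega

/-- **the degree-`k` row vanishes on the residues `q % m ∈ {1, …, m − k − 1}`** (rank form; every field, `m ≥ 1`, `n`, `a, c ≠ 0`). -/
theorem finrank_range_blockProj_wedge_pairBox_eq_zero_of_lt_mod (hm : 1 ≤ m) {a c : K} (ha : a ≠ 0) (hc : c ≠ 0) {k q : ℕ}
    (hk : k < (m - q % m) % m) :
    finrank K (LinearMap.range (blockProj K m n q ∘ₗ wedge K (Fin ((m + m) * n)) k (pairBox K (m := m) (n := n) a c))) = 0 :=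
  finrank_range_blockProj_wedge_pairBox_eq_zero_of_forall_not_dvd K hm ha hc (forall_not_dvd_of_lt_mod hm hk)

/-- arithmetic form: `genCount m n k q = 0` whenever `k < (m − q % m) % m` (`m ≥ 1`). -/
theorem genCount_eq_zero_of_lt_mod (hm : 1 ≤ m) (n : ℕ) {k q : ℕ} (hk : k < (m - q % m) % m) :
    FormulaN.Uniform.genCount m n k q = 0 :=
  genCount_eq_zero_of_forall_not_dvd hm n (forall_not_dvd_of_lt_mod hm hk)

/-- **the zeros of record are residue zeros**, for EVERY `n`: at threefold factors (`m = 3`) the degree-1 row vanishes at `q ≡ 1 (mod 3)`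
(the `0`s of `(9,0,9,9,0,9,9,0,9,0)`); at fourfold factors (`m = 4`) the degree-2 row vanishes at `q ≡ 1 (mod 4)` (the `0`s at
`q = 1, 5, 9` of `(66,0,18,96,66,0,66,96,18,0,66,0,0)` and C13's `(28,0,12,32,12,0,28)`) and the degree-1 row at `q ≡ 1, 2 (mod 4)`;
at fivefold factors the degree-2 row vanishes at `q ≡ 1, 2 (mod 5)` (C13's `(45,0,0,20,50,20,0,0,45)`). -/
theorem genCount_residue_zeros (n j : ℕ) :
    FormulaN.Uniform.genCount 3 n 1 (3 * j + 1) = 0 ∧ FormulaN.Uniform.genCount 4 n 2 (4 * j + 1) = 0 ∧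
      FormulaN.Uniform.genCount 4 n 1 (4 * j + 1) = 0 ∧ FormulaN.Uniform.genCount 4 n 1 (4 * j + 2) = 0 ∧
      FormulaN.Uniform.genCount 5 n 2 (5 * j + 1) = 0 ∧ FormulaN.Uniform.genCount 5 n 2 (5 * j + 2) = 0 := by
  refine ⟨genCount_eq_zero_of_lt_mod (by norm_num) n (by omega), genCount_eq_zero_of_lt_mod (by norm_num) n (by omega),
    genCount_eq_zero_of_lt_mod (by norm_num) n (by omega), genCount_eq_zero_of_lt_mod (by norm_num) n (by omega),
    genCount_eq_zero_of_lt_mod (by norm_num) n (by omega), genCount_eq_zero_of_lt_mod (by norm_num) n (by omega)⟩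

/-! ## §3. Sufficiency: a class for every admissible `(k, q)`, by induction on `n` -/

/-- one more block in front: degree, fixed `q`-part and empty count add up. -/
lemma kf_cons (o : Opt m) (f : Fin n → Opt m) : kf (Fin.cons o f : Fin (n + 1) → Opt m) = o.1.card + kf f := by
  simp only [kf, Fin.sum_univ_succ, Fin.cons_zero, Fin.cons_succ]

/-- (same for the fixed `q`-part) -/
lemma qff_cons (o : Opt m) (f : Fin n → Opt m) : qff (Fin.cons o f : Fin (n + 1) → Opt m) = lqf m o + qff f := by
  simp only [qff, Fin.sum_univ_succ, Fin.cons_zero, Fin.cons_succ]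

/-- (same for the number of empty blocks) -/
lemma zf_cons (o : Opt m) (f : Fin n → Opt m) : zf (Fin.cons o f : Fin (n + 1) → Opt m) = lz m o + zf f := by
  simp only [zf, Fin.sum_univ_succ, Fin.cons_zero, Fin.cons_succ]

/-- a non-empty `X`-source has `q`-part `m − |o|` and is not the empty source. -/
lemma lqf_of_subset_Xs (o : Opt m) (h : o.1 ⊆ Xs m) (hne : o.1 ≠ ∅) : lqf m o = m - o.1.card ∧ lz m o = 0 :=
  ⟨if_pos ⟨h, hne⟩, if_neg hne⟩

/-- a non-empty (proper) `Y`-source has `q`-part `0` and is not the empty source. -/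
lemma lqf_of_subset_Ys (o : Opt m) (h : o.1 ⊆ Ys m) (hne : o.1 ≠ ∅) : lqf m o = 0 ∧ lz m o = 0 := by
  refine ⟨if_neg fun hX => ?_, if_neg hne⟩
  obtain ⟨x, hx⟩ := Finset.nonempty_iff_ne_empty.mpr hne
  exact Finset.disjoint_left.mp (WedgePair.disjoint_XY m) (hX.1 hx) (h hx)

/-- the top collapse has `q`-part `0` and is not empty (`m ≥ 1`); the empty source has `q`-part `0` and `z = 1`. -/
lemma lqf_oTop_and (hm : 1 ≤ m) :
    lqf m (oTop m) = 0 ∧ lz m (oTop m) = 0 ∧ lqf m (oEmpty m) = 0 ∧ lz m (oEmpty m) = 1 := by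
  have hpos : 0 < (Xs m).card := by rw [WedgePair.card_Xset]; exact hm
  have hne : (Xs m : Finset (Fin (m + m))) ≠ ∅ := (Finset.card_pos.mp hpos).ne_empty
  refine ⟨?_, if_neg hne, Ys_mem_ltg_empty.2.2.2, if_pos rfl⟩
  show (if (Xs m ⊆ Xs m ∧ Xs m ≠ ∅) then m - (Xs m).card else 0) = 0
  rw [if_pos ⟨subset_rfl, hne⟩, WedgePair.card_Xset, Nat.sub_self]

/-- **SUFFICIENCY**: for `k + q ≤ mn`, `s ≤ k`, `m ∣ q + s` there IS option data of degree `k` whose class reaches block `q`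
(`m ≥ 1`; induction on `n`, peeling the first block as in the file header). -/
theorem exists_mem_Fset (hm : 1 ≤ m) :
    ∀ (n k q s : ℕ), k + q ≤ m * n → s ≤ k → m ∣ q + s → ∃ f : Fin n → Opt m, kf f = k ∧ ∃ j, j ≤ zf f ∧ q = qff f + m * j := by
  intro n
  induction n with
  | zero =>
    intro k q s hkq hs hd
    refine ⟨fun i => i.elim0, ?_, 0, Nat.zero_le _, ?_⟩
    · rw [kf, Finset.univ_eq_empty, Finset.sum_empty]; omega
    · rw [qff, Finset.univ_eq_empty, Finset.sum_empty]; omega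
  | succ n ih =>
    intro k q s hkq hs hd
    rw [Nat.mul_succ] at hkq
    by_cases hs0 : s = 0
    · subst hs0
      rw [add_zero] at hd
      by_cases hq0 : q = 0
      · subst hq0
        -- all the degree on `q`-part-`0` sources, no shift
        by_cases hkm : m ≤ k
        · obtain ⟨f, hkf, j, hj, hq⟩ := ih (k - m) 0 0 (by omega) (Nat.zero_le _) (dvd_zero m)
          refine ⟨Fin.cons (oTop m) f, ?_, j, ?_, ?_⟩
          · rw [kf_cons, hkf]; change (Xs m).card + (k - m) = k; rw [WedgePair.card_Xset]; omega
          · rw [zf_cons, (lqf_oTop_and hm).2.1]; omega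
          · rw [qff_cons, (lqf_oTop_and hm).1]; omega
        · by_cases hk0 : k = 0
          · subst hk0
            obtain ⟨f, hkf, j, hj, hq⟩ := ih 0 0 0 (by omega) le_rfl (dvd_zero m)
            refine ⟨Fin.cons (oEmpty m) f, ?_, j, ?_, ?_⟩
            · rw [kf_cons, hkf, Ys_mem_ltg_empty.2.2.1, Finset.card_empty]
            · rw [zf_cons]; omega
            · rw [qff_cons, (lqf_oTop_and hm).2.2.1]; omega
          · obtain ⟨t, ht, htc⟩ := Finset.exists_subset_card_eq (s := Ys m) (n := k) (by rw [WedgePair.card_Yset]; omega)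
            obtain ⟨f, hkf, j, hj, hq⟩ := ih 0 0 0 (by omega) le_rfl (dvd_zero m)
            have hne : t ≠ ∅ := fun h => by rw [h, Finset.card_empty] at htc; omega
            let o : Opt m := ⟨t, mem_optSet.mpr (Or.inr ⟨ht, by omega, by omega⟩)⟩
            have hY := lqf_of_subset_Ys o ht hne
            refine ⟨Fin.cons o f, ?_, j, ?_, ?_⟩
            · rw [kf_cons, hkf]; change t.card + 0 = k; omega
            · rw [zf_cons, hY.2]; omega
            · rw [qff_cons, hY.1]; omega
      · -- `s = 0`, `q ≥ m`: an empty block, shifted once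
        have hmq : m ≤ q := Nat.le_of_dvd (by omega) hd
        obtain ⟨f, hkf, j, hj, hq⟩ := ih k (q - m) 0 (by omega) (Nat.zero_le _)
          (by rw [add_zero, show q - m = q + 0 - m by omega]; exact Nat.dvd_sub hd dvd_rfl)
        refine ⟨Fin.cons (oEmpty m) f, ?_, j + 1, ?_, ?_⟩
        · rw [kf_cons, hkf, Ys_mem_ltg_empty.2.2.1, Finset.card_empty, zero_add]
        · rw [zf_cons, (lqf_oTop_and hm).2.2.2]; omega
        · rw [qff_cons, (lqf_oTop_and hm).2.2.1, Nat.mul_succ]; omega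
    · have hms : m ≤ q + s := Nat.le_of_dvd (by omega) hd
      by_cases hsm : s ≤ m
      · -- an `X`-source with `s` letters, `q`-part `m − s`
        obtain ⟨t, ht, htc⟩ := Finset.exists_subset_card_eq (s := Xs m) (n := s) (by rw [WedgePair.card_Xset]; exact hsm)
        have hne : t ≠ ∅ := fun h => by rw [h, Finset.card_empty] at htc; omega
        obtain ⟨f, hkf, j, hj, hq⟩ := ih (k - s) (q - (m - s)) 0 (by omega) (Nat.zero_le _)
          (by rw [add_zero, show q - (m - s) = q + s - m by omega]; exact Nat.dvd_sub hd dvd_rfl)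
        let o : Opt m := ⟨t, mem_optSet.mpr (Or.inl ht)⟩
        have hX := lqf_of_subset_Xs o ht hne
        refine ⟨Fin.cons o f, ?_, j, ?_, ?_⟩
        · rw [kf_cons, hkf]; change t.card + (k - s) = k; omega
        · rw [zf_cons, hX.2]; omega
        · rw [qff_cons, hX.1]; change q = m - t.card + qff f + m * j; rw [htc]; omega
      · -- the top collapse: `m` letters, `q`-part `0`
        obtain ⟨f, hkf, j, hj, hq⟩ := ih (k - m) q (s - m) (by omega) (by omega)
          (by rw [show q + (s - m) = q + s - m by omega]; exact Nat.dvd_sub hd dvd_rfl)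
        refine ⟨Fin.cons (oTop m) f, ?_, j, ?_, ?_⟩
        · rw [kf_cons, hkf]; change (Xs m).card + (k - m) = k; rw [WedgePair.card_Xset]; omega
        · rw [zf_cons, (lqf_oTop_and hm).2.1]; omega
        · rw [qff_cons, (lqf_oTop_and hm).1]; omega

/-! ## §4. THE EXACT SUPPORT THEOREM -/

/-- **THE EXACT SUPPORT (class form)**: degree-`k` classes reach block `q` iff `k + q ≤ mn` and `m ∣ q + s` for some `s ≤ k` (`m ≥ 1`). -/
theorem Fset_nonempty_iff (hm : 1 ≤ m) {k q : ℕ} :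
    (Fset m n k q).Nonempty ↔ k + q ≤ m * n ∧ ∃ s, s ≤ k ∧ m ∣ q + s := by
  constructor
  · rintro ⟨f, hf⟩
    exact ⟨add_le_of_mem_Fset hf, exists_dvd_of_mem_Fset hf⟩
  · rintro ⟨hkq, s, hs, hd⟩
    obtain ⟨f, hk, j, hj, hq⟩ := exists_mem_Fset hm n k q s hkq hs hd
    exact ⟨f, mem_Fset.mpr ⟨hk, j, hj, hq⟩⟩

/-- **THE EXACT SUPPORT THEOREM, UNIFORM IN `m`, `n` AND `k`.**  For every field `K`, every `m ≥ 1`, `n`, `k`, `q` and `a, c ≠ 0`: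
the `q`-block of `θ ↦ θ ∧ F` on `⋀^k K^{(m+m)n}` is NON-ZERO iff `k + q ≤ mn` and `m ∣ q + s` for some `0 ≤ s ≤ k` — the degree-`k`
per-`q` row is supported exactly on the window `q ≤ mn − k` intersected with the residues `q ≡ 0, −1, …, −k (mod m)`. -/
theorem finrank_range_blockProj_wedge_pairBox_ne_zero_iff (hm : 1 ≤ m) {a c : K} (ha : a ≠ 0) (hc : c ≠ 0) {k q : ℕ} :
    finrank K (LinearMap.range (blockProj K m n q ∘ₗ wedge K (Fin ((m + m) * n)) k (pairBox K (m := m) (n := n) a c))) ≠ 0 ↔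
      k + q ≤ m * n ∧ ∃ s, s ≤ k ∧ m ∣ q + s := by
  rw [finrank_range_blockProj_wedge_pairBox_eq_card K hm ha hc, Finset.card_ne_zero, Fset_nonempty_iff hm]

/-- arithmetic form: **`genCount m n k q ≠ 0 ⟺ k + q ≤ mn ∧ ∃ s ≤ k, m ∣ q + s`** (`m ≥ 1`) — the exact support of the
coefficients of p10's enumerator `G_{m,n}(t,u)`. -/
theorem genCount_ne_zero_iff (hm : 1 ≤ m) {k q : ℕ} :
    FormulaN.Uniform.genCount m n k q ≠ 0 ↔ k + q ≤ m * n ∧ ∃ s, s ≤ k ∧ m ∣ q + s := by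
  rw [← card_Fset (n := n) hm, Finset.card_ne_zero, Fset_nonempty_iff hm]

/-- residue arithmetic: `∃ s ≤ k, m ∣ q + s` iff `(m − q % m) % m ≤ k` — the least such `s` is the distance from `q` up to the next
multiple of `m` (`m ≥ 1`). -/
theorem exists_dvd_iff_mod_le (hm : 1 ≤ m) (k q : ℕ) : (∃ s, s ≤ k ∧ m ∣ q + s) ↔ (m - q % m) % m ≤ k := by
  have hdm := Nat.div_add_mod q m
  have hlt : q % m < m := Nat.mod_lt q (by omega)
  constructor
  · rintro ⟨s, hs, hd⟩
    have hd' : m ∣ q % m + s := by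
      have e : q % m + s = q + s - m * (q / m) := by omega
      rw [e]
      exact Nat.dvd_sub hd (dvd_mul_right m (q / m))
    by_cases h0 : q % m = 0
    · rw [h0, Nat.sub_zero, Nat.mod_self]; exact Nat.zero_le k
    · rw [Nat.mod_eq_of_lt (show m - q % m < m by omega)]
      rcases Nat.eq_zero_or_pos (q % m + s) with hz | hpos
      · omega
      · have := Nat.le_of_dvd hpos hd'
        omega
  · intro hk
    by_cases h0 : q % m = 0
    · exact ⟨0, Nat.zero_le k, by rw [add_zero]; exact Nat.dvd_of_mod_eq_zero h0⟩
    · rw [Nat.mod_eq_of_lt (show m - q % m < m by omega)] at hk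
      refine ⟨m - q % m, hk, ⟨q / m + 1, ?_⟩⟩
      rw [Nat.mul_succ]
      omega

/-! ## §5. STRUCTURE C13's five Dolbeault indices are the support law at two factors in degree 2 -/

/-- **C13's five `q`-values `(0, m−2, m−1, m, 2m−2)` = the exact support at `n = 2`, `k = 2`** (every `m ≥ 3`): the window
`q ≤ 2m − 2` and the residues `q ≡ 0, −1, −2 (mod m)` leave exactly the five Dolbeault indices of the signed column
`(2m²−m, m²−m, 2m², m²−m, 2m²−m)` (`FormulaNUniform.sigmaBlockRank`). -/
theorem genCount_two_factors_two_ne_zero_iff (hm : 3 ≤ m) (q : ℕ) :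
    FormulaN.Uniform.genCount m 2 2 q ≠ 0 ↔ q = 0 ∨ q = m - 2 ∨ q = m - 1 ∨ q = m ∨ q = 2 * m - 2 := by
  rw [genCount_ne_zero_iff (n := 2) (by omega)]
  constructor
  · rintro ⟨hle, s, hs, ⟨c, hc⟩⟩
    have hc2 : c ≤ 2 := by
      by_contra h
      have h3 : m * 3 ≤ m * c := Nat.mul_le_mul_left m (by omega)
      omega
    interval_cases c <;> interval_cases s <;> omega
  · rintro (h | h | h | h | h)
    · exact ⟨by omega, 0, by omega, ⟨0, by omega⟩⟩
    · exact ⟨by omega, 2, le_rfl, ⟨1, by omega⟩⟩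
    · exact ⟨by omega, 1, by omega, ⟨1, by omega⟩⟩
    · exact ⟨by omega, 0, by omega, ⟨1, by omega⟩⟩
    · exact ⟨by omega, 2, le_rfl, ⟨2, by omega⟩⟩

/-- the same as a RANK statement: at two `m`-dimensional factors (`m ≥ 3`) the degree-2 block `q` of `θ ↦ θ ∧ (f₀ ∧ f₁)` is non-zero
exactly at C13's five indices. -/
theorem finrank_range_blockProj_wedge_pairBox_two_factors_two_ne_zero_iff (hm : 3 ≤ m) {a c : K} (ha : a ≠ 0) (hc : c ≠ 0) (q : ℕ) :
    finrank K (LinearMap.range (blockProj K m 2 q ∘ₗ wedge K (Fin ((m + m) * 2)) 2 (pairBox K (m := m) (n := 2) a c))) ≠ 0 ↔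
      q = 0 ∨ q = m - 2 ∨ q = m - 1 ∨ q = m ∨ q = 2 * m - 2 := by
  rw [finrank_range_blockProj_wedge_pairBox K (by omega) ha hc, genCount_two_factors_two_ne_zero_iff hm]

end Summit.Ventures.HSemireg.Wedge.PairPowers
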